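import Summits.AtomisticToContinuum.FouriersLaw.Theorems.JunctionLocalityNonBallisticContactCurrentFourthMomentMajorant

/-!
# The `N`-uniform fourth moment of the bond currents under the Gibbs state (every bond)

STATUS (w-FSD, piece FS-D of `stub_lightConeWindow`, stmt-AtomisticToContinuum-9127): (D1) LANDED
p89153 (`pinnedChain_gibbsExpMomentGrowth`); (D2b) `…ContactCurrentFourthMomentMajorant`; (D2) this
file, registered sub-goal `pinnedChain_contactCurrentFourthMoment` (light imports, no reflection).

Helper (`--supports`) for the line `contact-current-forgetting` of the crux
`JunctionLocality.NonBallistic` (stmt-AtomisticToContinuum-9127), stub `stub_lightConeWindow` (LC),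
piece FS-D (Gibbs STATICS with controlled `N`-dependence), part (D2): for the pinned anharmonic
chain `P = pinnedChain ω₂ lam β γ` (`ω₂ > 0`, `lam, β ≥ 0`, any `γ`) and `T > 0`,
`∃ C ≥ 0, ∀ N, ∀ k : Fin N, j_k⁴ ∈ L¹(μ_T^N) ∧ ∫ j_k⁴ dμ_T^N ≤ C` — EVERY bond, uniformly in `N`
and `k` (`μ_T^N = P.gibbsMeasure N T`, `j_k = P.bondCurrent N k = -½ (p_k + p_{k+1}) V'(q_{k+1} - q_k)`,
`V'(r) = r + βr³`; the far contact bond `k = N-2` is the case the flip-insensitivity assembly uses).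

Proof. Pointwise `j_k⁴ ≤ (1+β)⁴ 2¹⁰ F`, `F = (p_k⁴ + p_{k+1}⁴)(1 + q_k¹² + q_{k+1}¹²)` (power mean,
`(r + βr³)⁴ ≤ (1+β)⁴(1 + r¹²)`, `(q' - q)¹² ≤ 2¹¹(q¹² + q'¹²)`); the weighted-Lebesgue inequality
`(∫⁻ F e^{-H/T})(B m₀) ≤ ((B + 2A) 2m₄) ∫⁻ e^{-H/T}` of the helper file (constants independent of
`N, k`) is transferred to the Gibbs state by `pinnedChain_integrable_and_integral_le_of_lintegral`;
the last site carries no bond (`j_{N-1} = 0`). All folklore.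
-/

noncomputable section

open MeasureTheory Set
open scoped ENNReal

namespace Summit.AtomisticToContinuum.FouriersLaw.Theorems.NonBallistic

open Literature.MathematicalPhysics.KineticTheory.HeatConduction
open Summit.AtomisticToContinuum.FouriersLaw.Theorems.SubdiffusiveBondHeat
open Summit.AtomisticToContinuum.FouriersLaw.Theorems.PhononMeanFreePath
  (lightCone_radMono_ofReal_pow_even lightCone_lintegral_pow_exp_neg_U_ne_top)
open Summit.AtomisticToContinuum.FouriersLaw.Theorems.ChainVariation (lintegral_coord_potential_le)

variable {ω₂ lam β : ℝ}

/-! ## Transfer of a weighted-Lebesgue inequality to the Gibbs state -/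

/-- **Transfer to the Gibbs state.** If a continuous `F ≥ 0` on phase space satisfies
`(∫⁻ F e^{-H/T}) · B ≤ A · ∫⁻ e^{-H/T}` with `A < ∞`, `0 < B < ∞`, then `F ∈ L¹(μ_T^N)` and
`∫ F dμ_T^N ≤ A/B`. [folklore] -/
theorem pinnedChain_integrable_and_integral_le_of_lintegral (hω : 0 < ω₂) (hl : 0 ≤ lam)
    (hβ : 0 ≤ β) (γ : ℝ) {T : ℝ} (hT : 0 < T) {N : ℕ} {F : PhaseSpace N → ℝ} (hFc : Continuous F)
    (hF0 : ∀ z, 0 ≤ F z) {A B : ℝ≥0∞} (hA : A ≠ ⊤) (hB0 : B ≠ 0) (hB : B ≠ ⊤)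
    (key : (∫⁻ z, ENNReal.ofReal (F z * (pinnedChain ω₂ lam β γ).gibbsDensity N T z)) * B ≤
      A * ∫⁻ z, ENNReal.ofReal ((pinnedChain ω₂ lam β γ).gibbsDensity N T z)) :
    Integrable F ((pinnedChain ω₂ lam β γ).gibbsMeasure N T) ∧
      ∫ z, F z ∂((pinnedChain ω₂ lam β γ).gibbsMeasure N T) ≤ A.toReal / B.toReal := by
  -- adapted from `SubdiffusiveBondHeat.pinnedChain_integrable_and_moment_le` (`(z.1 i)^8 → F z`)
  set P := pinnedChain ω₂ lam β γ with hP
  have hρc : Continuous (P.gibbsDensity N T) := pinnedChain_continuous_gibbsDensity ω₂ lam β γ N T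
  have hρi : Integrable (P.gibbsDensity N T) := pinnedChain_integrable_gibbsDensity hω hl hβ γ N hT
  have hZfin : ∫⁻ z : PhaseSpace N, ENNReal.ofReal (P.gibbsDensity N T z) ≠ ⊤ :=
    (lintegral_ofReal_ne_top_iff_integrable hρi.aestronglyMeasurable
      (ae_of_all _ fun z => (P.gibbsDensity_pos N T z).le)).mpr hρi
  have hIfin : ∫⁻ z : PhaseSpace N, ENNReal.ofReal (F z * P.gibbsDensity N T z) ≠ ⊤ := by
    intro h
    rw [h, ENNReal.top_mul hB0] at key
    exact absurd key (not_le.mpr (ENNReal.mul_lt_top hA.lt_top hZfin.lt_top))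
  have hc : Continuous fun z : PhaseSpace N => F z * P.gibbsDensity N T z := hFc.mul hρc
  have hnn : ∀ z : PhaseSpace N, 0 ≤ F z * P.gibbsDensity N T z := fun z =>
    mul_nonneg (hF0 z) (P.gibbsDensity_pos N T z).le
  have hInt : Integrable (fun z : PhaseSpace N => F z * P.gibbsDensity N T z) :=
    (lintegral_ofReal_ne_top_iff_integrable hc.aestronglyMeasurable (ae_of_all _ hnn)).mp hIfin
  refine ⟨P.integrable_gibbsMeasure hInt, ?_⟩
  rw [P.integral_gibbsMeasure]
  have hZpos : 0 < ∫ z, P.gibbsDensity N T z := integral_exp_pos hρi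
  have e1 : ENNReal.ofReal (∫ z : PhaseSpace N, F z * P.gibbsDensity N T z) =
      ∫⁻ z : PhaseSpace N, ENNReal.ofReal (F z * P.gibbsDensity N T z) :=
    ofReal_integral_eq_lintegral_ofReal hInt (ae_of_all _ hnn)
  have e2 : ENNReal.ofReal (∫ z, P.gibbsDensity N T z) =
      ∫⁻ z : PhaseSpace N, ENNReal.ofReal (P.gibbsDensity N T z) :=
    ofReal_integral_eq_lintegral_ofReal hρi (ae_of_all _ fun z => (P.gibbsDensity_pos N T z).le)
  have hreal : (∫ z : PhaseSpace N, F z * P.gibbsDensity N T z) * B.toReal ≤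
      A.toReal * ∫ z, P.gibbsDensity N T z := by
    have := ENNReal.toReal_mono (ENNReal.mul_ne_top hA hZfin) key
    rwa [ENNReal.toReal_mul, ENNReal.toReal_mul, ← e1, ← e2,
      ENNReal.toReal_ofReal (integral_nonneg hnn), ENNReal.toReal_ofReal hZpos.le] at this
  have hBpos : 0 < B.toReal := ENNReal.toReal_pos hB0 hB
  rw [inv_mul_le_iff₀ hZpos, mul_div_assoc', le_div_iff₀ hBpos]
  linarith [mul_comm A.toReal (∫ z, P.gibbsDensity N T z)]

/-! ## The kinetic one-site constants and the kinetic marginal -/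

/-- The kinetic one-site weight is the one-site weight of the harmonic chain `pinnedChain 1 0 0 0`:
`e^{-(a²/2)/T} = e^{-U₁(a)/T}`, `U₁(a) = 1·a²/2 + 0·a⁴/4`. [folklore] -/
theorem exp_neg_kinetic_eq (a T : ℝ) :
    Real.exp (-(a ^ 2 / 2) / T) = Real.exp (-(pinnedChain 1 0 0 0).U a / T) := by
  congr 1
  show -(a ^ 2 / 2) / T = -(1 * a ^ 2 / 2 + 0 * a ^ 4 / 4) / T
  ring

/-! ## Pointwise control of `j_k⁴` -/

/-- Power mean: `((a + b)/2)⁴ ≤ (a⁴ + b⁴)/2`. [folklore] -/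
theorem add_div_two_pow_four_le (a b : ℝ) : ((a + b) / 2) ^ 4 ≤ (a ^ 4 + b ^ 4) / 2 := by
  have h1 : (a + b) ^ 2 ≤ 2 * (a ^ 2 + b ^ 2) := by nlinarith [sq_nonneg (a - b)]
  have h2 : (a + b) ^ 4 ≤ 8 * (a ^ 4 + b ^ 4) := by
    have h3 : (a + b) ^ 2 * (a + b) ^ 2 ≤ (2 * (a ^ 2 + b ^ 2)) * (2 * (a ^ 2 + b ^ 2)) :=
      mul_le_mul h1 h1 (sq_nonneg _) (by positivity)
    nlinarith [sq_nonneg (a ^ 2 - b ^ 2)]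
  rw [div_pow]
  norm_num
  linarith

/-- The fourth power of the contact force is controlled by twelfth moments:
`(r + βr³)⁴ ≤ (1+β)⁴ (1 + r¹²)` (`β ≥ 0`; cases `|r| ≤ 1`, `|r| ≥ 1`). [folklore] -/
theorem pow_four_deriv_V_le (hβ : 0 ≤ β) (r : ℝ) :
    (r + β * r ^ 3) ^ 4 ≤ (1 + β) ^ 4 * (1 + r ^ 12) := by
  have habs : |r + β * r ^ 3| ≤ |r| + β * |r| ^ 3 := by
    calc |r + β * r ^ 3| ≤ |r| + |β * r ^ 3| := abs_add_le _ _
      _ = |r| + β * |r| ^ 3 := by rw [abs_mul, abs_of_nonneg hβ, abs_pow]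
  have ht : 0 ≤ |r| := abs_nonneg r
  have h12 : |r| ^ 12 = r ^ 12 := Even.pow_abs ⟨6, rfl⟩ r
  have hL : (r + β * r ^ 3) ^ 4 ≤ (|r| + β * |r| ^ 3) ^ 4 := by
    rw [← Even.pow_abs ⟨2, rfl⟩ (r + β * r ^ 3)]
    exact pow_le_pow_left₀ (abs_nonneg _) habs 4
  refine hL.trans ?_
  rcases le_total |r| 1 with h | h
  · have h3 : |r| ^ 3 ≤ 1 := pow_le_one₀ ht h
    have hu : |r| + β * |r| ^ 3 ≤ 1 + β := add_le_add h (mul_le_of_le_one_right hβ h3)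
    calc (|r| + β * |r| ^ 3) ^ 4 ≤ (1 + β) ^ 4 := pow_le_pow_left₀ (by positivity) hu 4
      _ ≤ (1 + β) ^ 4 * (1 + r ^ 12) :=
          le_mul_of_one_le_right (by positivity) (by linarith [(show 0 ≤ r ^ 12 by positivity)])
  · have h3 : |r| ≤ |r| ^ 3 := le_self_pow₀ h (by norm_num)
    have hu : |r| + β * |r| ^ 3 ≤ (1 + β) * |r| ^ 3 := by nlinarith
    calc (|r| + β * |r| ^ 3) ^ 4 ≤ ((1 + β) * |r| ^ 3) ^ 4 := pow_le_pow_left₀ (by positivity) hu 4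
      _ = (1 + β) ^ 4 * r ^ 12 := by rw [mul_pow, ← pow_mul, h12]
      _ ≤ (1 + β) ^ 4 * (1 + r ^ 12) :=
          mul_le_mul_of_nonneg_left (by linarith) (by positivity)

/-- `(b - a)¹² ≤ 2¹¹ (a¹² + b¹²)`. [folklore] -/
theorem sub_pow_twelve_le (a b : ℝ) : (b - a) ^ 12 ≤ 2 ^ 11 * (a ^ 12 + b ^ 12) := by
  have h1 : (b - a) ^ 12 = |b - a| ^ 12 := (Even.pow_abs ⟨6, rfl⟩ (b - a)).symm
  have h2 : |b - a| ≤ |a| + |b| := by rw [abs_sub_comm]; exact abs_sub a b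
  have h3 := add_pow_le (abs_nonneg a) (abs_nonneg b) 12
  rw [Even.pow_abs ⟨6, rfl⟩ a, Even.pow_abs ⟨6, rfl⟩ b] at h3
  norm_num at h3
  rw [show (2048 : ℝ) = 2 ^ 11 by norm_num] at h3
  rw [h1]
  exact (pow_le_pow_left₀ (abs_nonneg _) h2 12).trans h3

/-- Closed form of the bond current `j_k = -½ (p_k + p_{k'}) V'(q_{k'} - q_k)` across the bond
`(k, k')`, `k' = k + 1`, with `V'(r) = r + βr³`. [folklore] -/
theorem pinnedChain_bondCurrent_eq_of_succ (ω₂ lam β γ : ℝ) {N : ℕ} (k k' : Fin N)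
    (hk : k'.val = k.val + 1) (z : PhaseSpace N) :
    (pinnedChain ω₂ lam β γ).bondCurrent N k z =
      -((z.2 k + z.2 k') / 2 * (z.1 k' - z.1 k + β * (z.1 k' - z.1 k) ^ 3)) := by
  unfold OscillatorChain.bondCurrent
  rw [Finset.sum_eq_single k']
  · rw [if_pos hk, pinnedChain_deriv_V]
  · intro j _ hj
    exact if_neg fun h => hj (Fin.ext (by omega))
  · intro h; exact absurd (Finset.mem_univ _) h

/-- **Pointwise bound.** `j_k⁴ ≤ (1+β)⁴ 2¹⁰ · (p_k⁴ + p_{k'}⁴)(1 + q_k¹² + q_{k'}¹²)` across the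
bond `(k, k')`, `k' = k + 1` (`β ≥ 0`). [folklore] -/
theorem pinnedChain_bondCurrent_pow_four_le (hβ : 0 ≤ β) (ω₂ lam γ : ℝ) {N : ℕ} (k k' : Fin N)
    (hk : k'.val = k.val + 1) (z : PhaseSpace N) :
    (pinnedChain ω₂ lam β γ).bondCurrent N k z ^ 4 ≤
      (1 + β) ^ 4 * 2 ^ 10 * ((z.2 k ^ 4 + z.2 k' ^ 4) * (1 + z.1 k ^ 12 + z.1 k' ^ 12)) := by
  rw [pinnedChain_bondCurrent_eq_of_succ ω₂ lam β γ k k' hk]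
  have e : (-((z.2 k + z.2 k') / 2 * (z.1 k' - z.1 k + β * (z.1 k' - z.1 k) ^ 3))) ^ 4 =
      ((z.2 k + z.2 k') / 2) ^ 4 * (z.1 k' - z.1 k + β * (z.1 k' - z.1 k) ^ 3) ^ 4 := by ring
  rw [e]
  have hp := add_div_two_pow_four_le (z.2 k) (z.2 k')
  have hv := pow_four_deriv_V_le hβ (z.1 k' - z.1 k)
  have hr := sub_pow_twelve_le (z.1 k) (z.1 k')
  have hq0 : 0 ≤ z.1 k ^ 12 := by positivity
  have hq1 : 0 ≤ z.1 k' ^ 12 := by positivity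
  have hq12 : 1 + (z.1 k' - z.1 k) ^ 12 ≤ 2 ^ 11 * (1 + z.1 k ^ 12 + z.1 k' ^ 12) := by
    nlinarith
  calc ((z.2 k + z.2 k') / 2) ^ 4 * (z.1 k' - z.1 k + β * (z.1 k' - z.1 k) ^ 3) ^ 4
      ≤ ((z.2 k ^ 4 + z.2 k' ^ 4) / 2) * ((1 + β) ^ 4 * (1 + (z.1 k' - z.1 k) ^ 12)) :=
        mul_le_mul hp hv (by positivity) (by positivity)
    _ ≤ ((z.2 k ^ 4 + z.2 k' ^ 4) / 2) * ((1 + β) ^ 4 * (2 ^ 11 * (1 + z.1 k ^ 12 + z.1 k' ^ 12))) := by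
        gcongr
    _ = (1 + β) ^ 4 * 2 ^ 10 * ((z.2 k ^ 4 + z.2 k' ^ 4) * (1 + z.1 k ^ 12 + z.1 k' ^ 12)) := by
        ring

/-! ## (D2) The `N`-uniform fourth moment of the bond currents -/

/-- **(D2) `N`- and site-uniform fourth moments of the bond currents under the Gibbs state.** For
the pinned anharmonic chain (`ω₂ > 0`, `lam, β ≥ 0`, any `γ`) and `T > 0` there is
`C = C(ω₂, lam, β, T) ≥ 0` such that for EVERY `N` and EVERY bond `k`: `j_k⁴ ∈ L¹(μ_T^N)` and
`∫ j_k⁴ dμ_T^N ≤ C` (in particular for the two contact bonds `k = 0`, `k = N-2`). Proof: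
`j_k⁴ ≤ (1+β)⁴2¹⁰ (p_k⁴ + p_{k+1}⁴)(1 + q_k¹² + q_{k+1}¹²)`; the Gibbs weight factorises into its
kinetic part (Gaussian, exact one-coordinate marginals) and its configurational part, whose
twelfth one-site moments are dominated by the one-site Gibbs state uniformly in `N` and in the
site (transfer recursion + Wintner + Chebyshev, `ChainVariation.lintegral_coord_potential_le`).
[folklore] -/
theorem pinnedChain_contactCurrentFourthMoment :
    ∀ ω₂ lam β γ : ℝ, 0 < ω₂ → 0 ≤ lam → 0 ≤ β → ∀ T : ℝ, 0 < T →
      ∃ C : ℝ, 0 ≤ C ∧ ∀ (N : ℕ) (k : Fin N),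
        Integrable (fun x => (pinnedChain ω₂ lam β γ).bondCurrent N k x ^ 4)
            ((pinnedChain ω₂ lam β γ).gibbsMeasure N T) ∧
        ∫ x, (pinnedChain ω₂ lam β γ).bondCurrent N k x ^ 4
            ∂((pinnedChain ω₂ lam β γ).gibbsMeasure N T) ≤ C := by
  intro ω₂ lam β γ hω hl hβ T hT
  set P := pinnedChain ω₂ lam β γ with hP
  -- the `N`-independent constants `A, B` (configurational) and `m₄, m₀` (kinetic)
  have hA : (∫⁻ a, ENNReal.ofReal (a ^ 12) * ENNReal.ofReal (Real.exp (-P.U a / T))) ≠ ⊤ :=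
    lightCone_lintegral_pow_exp_neg_U_ne_top hω hl γ hT 6
  have hB := pinnedChain_lintegral_exp_neg_U_ne_top (β := β) hω hl γ hT
  have hB0 := pinnedChain_lintegral_exp_neg_U_ne_zero ω₂ lam β γ T
  have hm4 : (∫⁻ a, ENNReal.ofReal (a ^ 4) * ENNReal.ofReal (Real.exp (-(a ^ 2 / 2) / T))) ≠ ⊤ := by
    simpa only [exp_neg_kinetic_eq] using
      lightCone_lintegral_pow_exp_neg_U_ne_top (β := 0) one_pos le_rfl 0 hT 2
  have hm0 : (∫⁻ a, ENNReal.ofReal (Real.exp (-(a ^ 2 / 2) / T))) ≠ ⊤ := by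
    simpa only [exp_neg_kinetic_eq] using pinnedChain_lintegral_exp_neg_U_ne_top one_pos le_rfl 0 hT
  have hm00 : (∫⁻ a, ENNReal.ofReal (Real.exp (-(a ^ 2 / 2) / T))) ≠ 0 := by
    simpa only [exp_neg_kinetic_eq] using pinnedChain_lintegral_exp_neg_U_ne_zero 1 0 0 0 T
  obtain ⟨Atot, hAtot_def, hAtot⟩ : ∃ Atot : ℝ≥0∞, Atot =
      ((∫⁻ a, ENNReal.ofReal (Real.exp (-P.U a / T))) +
          2 * ∫⁻ a, ENNReal.ofReal (a ^ 12) * ENNReal.ofReal (Real.exp (-P.U a / T))) *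
        (2 * ∫⁻ a, ENNReal.ofReal (a ^ 4) * ENNReal.ofReal (Real.exp (-(a ^ 2 / 2) / T))) ∧
      Atot ≠ ⊤ := by
    refine ⟨_, rfl, ENNReal.mul_ne_top ?_ (ENNReal.mul_ne_top (by simp) hm4)⟩
    exact ENNReal.add_ne_top.mpr ⟨hB, ENNReal.mul_ne_top (by simp) hA⟩
  obtain ⟨Btot, hBtot_def, hBtot0, hBtot⟩ : ∃ Btot : ℝ≥0∞, Btot =
      (∫⁻ a, ENNReal.ofReal (Real.exp (-P.U a / T))) *
        ∫⁻ a, ENNReal.ofReal (Real.exp (-(a ^ 2 / 2) / T)) ∧ Btot ≠ 0 ∧ Btot ≠ ⊤ :=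
    ⟨_, rfl, mul_ne_zero hB0 hm00, ENNReal.mul_ne_top hB hm0⟩
  have hc0 : 0 ≤ (1 + β) ^ 4 * 2 ^ 10 * (Atot.toReal / Btot.toReal) := by positivity
  refine ⟨(1 + β) ^ 4 * 2 ^ 10 * (Atot.toReal / Btot.toReal), hc0, fun N k => ?_⟩
  by_cases hkN : k.val + 1 < N
  · -- a genuine bond `(k, k+1)`
    obtain ⟨m, rfl⟩ : ∃ m, N = m + 1 := ⟨N - 1, by omega⟩
    set k' : Fin (m + 1) := ⟨k.val + 1, hkN⟩ with hk'
    have hkk' : k'.val = k.val + 1 := rfl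
    have key := pinnedChain_lintegral_majorant_mul_gibbsDensity_le ω₂ lam β γ hω hl hβ T hT m k k'
    rw [← hAtot_def, ← hBtot_def] at key
    obtain ⟨hFi, hFle⟩ := pinnedChain_integrable_and_integral_le_of_lintegral hω hl hβ γ hT
      (F := fun z : PhaseSpace (m + 1) =>
        (z.2 k ^ 4 + z.2 k' ^ 4) * (1 + z.1 k ^ 12 + z.1 k' ^ 12))
      (by fun_prop) (fun z => by positivity) hAtot hBtot0 hBtot key
    have hpt := pinnedChain_bondCurrent_pow_four_le hβ ω₂ lam γ k k' hkk'
    have hmaj : Integrable (fun z : PhaseSpace (m + 1) => (1 + β) ^ 4 * 2 ^ 10 *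
        ((z.2 k ^ 4 + z.2 k' ^ 4) * (1 + z.1 k ^ 12 + z.1 k' ^ 12))) (P.gibbsMeasure (m + 1) T) :=
      hFi.const_mul _
    have hjc : Continuous fun x => P.bondCurrent (m + 1) k x ^ 4 :=
      (pinnedChain_continuous_bondCurrent ω₂ lam β γ (m + 1) k).pow 4
    refine ⟨hmaj.mono' hjc.aestronglyMeasurable (ae_of_all _ fun z => ?_), ?_⟩
    · rw [Real.norm_eq_abs, abs_of_nonneg (by positivity)]
      exact hpt z
    · refine (integral_mono_of_nonneg (ae_of_all _ fun z => by positivity) hmaj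
        (ae_of_all _ hpt)).trans ?_
      rw [integral_const_mul]
      exact mul_le_mul_of_nonneg_left hFle (by positivity)
  · -- the last site carries no bond: `j_k = 0`
    have hj : ∀ x, P.bondCurrent N k x = 0 := fun x => by
      unfold OscillatorChain.bondCurrent
      refine Finset.sum_eq_zero fun j _ => ?_
      rw [if_neg (by have := j.isLt; omega)]
    have h0 : (fun x => P.bondCurrent N k x ^ 4) = fun _ => (0 : ℝ) := by
      funext x; rw [hj x]; norm_num
    rw [h0, integral_zero]
    exact ⟨integrable_zero _ _ _, hc0⟩

end Summit.AtomisticToContinuum.FouriersLaw.Theorems.NonBallistic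

end
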